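import Mathlib
import HarnessLib
import Summits.Ventures.LatticeQCDFlow.Scoring.DoeblinPowerBatchMeansCLT
import Summits.Ventures.LatticeQCDFlow.Scoring.DoeblinPowerBatchMeansTauInt
import Summits.Ventures.LatticeQCDFlow.Exactness.SUNMultiStepLeapfrogHMCEngine

/-!
# THE ENGINE'S MULTI-STEP (`nstep ≥ 1`) LEAPFROG HMC ON `SU(N)` LATTICE GAUGE FIELDS: CLT for time
# averages, consistent batch-means error bars, asymptotically exact coverage and a consistent `τ_int`,
# from ANY start, for short trajectories — every bounded observable, every bounded action (Wilson included)

HONEST FRAMING: exact (Metropolis-corrected) sampling algorithms for lattice gauge theory;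
figures of merit are autocorrelation/cost numbers at stated couplings and volumes; no
continuum-physics claim.

Venture `LatticeQCDFlow` (cell pub-lqcd), topic `Scoring`; FANOUT row 21 (`su3-base`: the arm `E2 = PBC-HMC`
runs the engine's `latflow.core.hmc.HMC(f, β, …).trajectory(τ, nstep)` with `nstep > 1` and reports time averages
of the plaquette, `t²E` and `Q²` with batch-means / Γ-method error bars).  NEW WORK of the cell, not a published
result; no definition is introduced; nothing is cited as a fact.  This is the `nstep ≥ 1` twin of row 8's
`Scoring/SUNLeapfrogHMCBatchMeans.lean` (which lists "`nstep ≥ 2`" as NOT CLAIMED), word for word over row 9's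
multi-step kernel `K = sunLeapfrogHMCN (sunCoordι N) (sunCoordι_skew N) ε addHaar (sunKinetic N) hg S nstep`
(`Exactness/SUNMultiStepLeapfrogHMC*.lean`: Gaussian momentum refresh in the engine's coordinates, `nstep` P-first
leapfrog steps of size `ε > 0` with ANY measurable momentum increment `g` bounded by `b` and `K_g`-Lipschitz in the
matrix sup norm, Metropolis test on `S + T`), for ANY measurable action `S` with `|S| ≤ s`, under row 9's
SHORT-TRAJECTORY conditions `nε, (2n+1)b, K_g ε n² ≤ s_N` (`s_N = sunShortTrajThreshold`).  Row 9 proved that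
`π_S = Z⁻¹ e^{−S} · Haar^{⊗links}` is invariant (`sunLeapfrogHMCN_invariant_gibbs`) and that a POWER of `K` is
Doeblin from every configuration (`sunLeapfrogHMCN_nHit_minorised`); row 8's `…_of_nHit` theorems
(`Scoring/DoeblinPowerBatchMeans*.lean`, `Exactness/NCMCGeneralSpace*`) turn that certificate into the error-bar
theory of a run `f(X_0), f(X_1), …` for every bounded measurable `f` and EVERY initial law.

## Content (`N ≥ 1`; `n ≥ 1`, `ε > 0`; `g` measurable, `‖g U l‖ ≤ b`, `K_g`-Lipschitz; `S` measurable, `|S| ≤ s`;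
## the three threshold conditions; `π_S = gibbsProbability Haar^{⊗L} e^{−S}`; `P_{μ₀}` the chain's path law)

* `sunLeapfrogHMCN_certificate` — `π_S` invariant and `∃ m > 0, ε' ∈ (0, 1]`, `ε' • Haar^{⊗L} ≤ K^m(U, ·)`;
* **`sunLeapfrogHMCN_timeAverage_clt`**, **`sunLeapfrogHMCN_batchMeans_tendstoInMeasure`**,
  **`sunLeapfrogHMCN_batchMeans_coverage`**, **`sunLeapfrogHMCN_tauInt_tendstoInMeasure`**;
* Wilson action (torus `(ℤ/L)^d`, continuous representation `ρ`, any `β`, `π_S = wilsonMeasure ρ β`):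
  **`wilson_sunLeapfrogHMCN_batchMeans_tendstoInMeasure`**, **`wilson_sunLeapfrogHMCN_batchMeans_coverage`**.
  With `g = −(ε/2)·sunWilsonForce N β` (row 21's `Exactness/SUNWilsonHMCForce.lean`) the hypotheses on `g` hold
  with `b = (ε/2)·sunWilsonForceSup`, `K_g = (ε/2)·sunWilsonForceLip` (not instantiated here).

NOT CLAIMED: anything beyond the short-trajectory threshold; any rate or constant; `σ²_f > 0` (assumed where
stated); OMF words / `tau_jitter`; floating point; unbounded observables.
-/

noncomputable section

namespace Summit.Ventures.LatticeQCDFlow.Scoring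

open MeasureTheory ProbabilityTheory Filter Finset Preorder Literature.Probability.MarkovChains
open Literature.MathematicalPhysics.QuantumFieldTheory
open Summit.Ventures.LatticeQCDFlow.Exactness
open scoped ENNReal Topology Matrix Matrix.Norms.Operator

set_option backward.isDefEq.respectTransparency false

section HMC

variable (N : ℕ) [NeZero N] {L : Type*} [Fintype L] {ε : ℝ} {nstep : ℕ}
  {g : (L → Matrix.specialUnitaryGroup (Fin N) ℂ) → L → SUNCoords N} {b Kg : ℝ}
  {S : (L → Matrix.specialUnitaryGroup (Fin N) ℂ) → ℝ} {s : ℝ}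

/-- **The certificate of the engine's single-step `SU(N)` leapfrog HMC**, packaged for the row's
`…_of_nHit` theorems: `π_S` is invariant and some power `K^m` (`m > 0`) dominates `ε' · Haar^{⊗L}`
from every configuration with `0 < ε' ≤ 1`. -/
theorem sunLeapfrogHMCN_certificate (hε : 0 < ε) (hn : 1 ≤ nstep) (hg : Measurable g) (hb0 : 0 ≤ b)
    (hb : ∀ u l, ‖g u l‖ ≤ b) (hK0 : 0 ≤ Kg) (hKg : ∀ U U', ‖g U - g U'‖ ≤ Kg * ‖coeConfig U - coeConfig U'‖)
    (hS : Measurable S) (hs : ∀ u, |S u| ≤ s)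
    (h1 : nstep * ε ≤ sunShortTrajThreshold (sunCoordι N) (sunCoordι_injective N))
    (h2 : (2 * nstep + 1) * b ≤ sunShortTrajThreshold (sunCoordι N) (sunCoordι_injective N))
    (h3 : Kg * ε * (nstep : ℝ) ^ 2 ≤ sunShortTrajThreshold (sunCoordι N) (sunCoordι_injective N)) :
    Kernel.Invariant (sunLeapfrogHMCN (sunCoordι N) (sunCoordι_skew N) ε
        (Measure.addHaar : Measure (SUNCoords N)) (sunKinetic N) hg S nstep)
      (gibbsProbability (Measure.pi fun _ : L => haarProbability (Matrix.specialUnitaryGroup (Fin N) ℂ))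
        fun u => Real.exp (-S u)) ∧
    ∃ m : ℕ, ∃ ε' : ℝ≥0∞, 0 < m ∧ 0 < ε' ∧ ε' ≤ 1 ∧ ∀ u,
      ε' • Measure.pi (fun _ : L => haarProbability (Matrix.specialUnitaryGroup (Fin N) ℂ)) ≤
        nHit (sunLeapfrogHMCN (sunCoordι N) (sunCoordι_skew N) ε
          (Measure.addHaar : Measure (SUNCoords N)) (sunKinetic N) hg S nstep) m u := by
  have hT := measurable_sunKinetic (L := L) N
  have hZ := sunMomentumWeight_sunKinetic_ne_top (L := L) N (Measure.addHaar : Measure (SUNCoords N))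
  haveI := isProbabilityMeasure_sunMomentumLaw (L := L) (Measure.addHaar : Measure (SUNCoords N))
    (sunKinetic N) hT hZ
  have hH : Measurable fun z : (L → Matrix.specialUnitaryGroup (Fin N) ℂ) × (L → SUNCoords N) =>
      S z.1 + sunKinetic N z.2 := (hS.comp measurable_fst).add (hT.comp measurable_snd)
  haveI : Fact (Measurable fun z : (L → Matrix.specialUnitaryGroup (Fin N) ℂ) × (L → SUNCoords N) =>
      S z.1 + sunKinetic N z.2) := ⟨hH⟩
  haveI : IsMarkovKernel (sunLeapfrogHMCN (sunCoordι N) (sunCoordι_skew N) ε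
      (Measure.addHaar : Measure (SUNCoords N)) (sunKinetic N) hg S nstep) := by
    unfold sunLeapfrogHMCN; infer_instance
  obtain ⟨k, δ, hδ0, hmin⟩ := sunLeapfrogHMCN_nHit_minorised (sunCoordι N) (sunCoordι_skew N)
    (sunCoordι_injective N) Measure.addHaar
    (τ := fun R => Fintype.card L * ((N + 4 * Fintype.card (UpperPair N)) * R ^ 2))
    (sunCoordι_range N) hε hn hT (sunKinetic_nonneg N)
    (sunKinetic_le_of_norm_le N) hZ hg hb0 hb hK0 hKg hS hs h1 h2 h3
  haveI : IsMarkovKernel (nHit (sunLeapfrogHMCN (sunCoordι N) (sunCoordι_skew N) ε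
      (Measure.addHaar : Measure (SUNCoords N)) (sunKinetic N) hg S nstep) (k + 1)) := isMarkovKernel_nHit _ _
  have hδ1 : δ ≤ 1 := by
    have h := Measure.le_iff'.1 (hmin fun _ => 1) Set.univ
    rwa [Measure.smul_apply, smul_eq_mul, measure_univ, measure_univ, mul_one] at h
  exact ⟨sunLeapfrogHMCN_invariant_gibbs (sunCoordι N) (sunCoordι_skew N) hg hT hZ hS nstep,
    k + 1, δ, Nat.succ_pos k, hδ0, hδ1, hmin⟩

/-- **THE CLT FOR TIME AVERAGES OF THE ENGINE'S `SU(N)` LEAPFROG HMC, FROM EVERY INITIAL LAW**: for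
`|f| ≤ C` measurable and `Y ~ N(0, σ²_f)`: `(√N')⁻¹ Σ_{t<N'} (f(X_t) − π_S f) ⇒ Y` under `P_{μ₀}`. -/
theorem sunLeapfrogHMCN_timeAverage_clt (hε : 0 < ε) (hn : 1 ≤ nstep) (hg : Measurable g) (hb0 : 0 ≤ b)
    (hb : ∀ u l, ‖g u l‖ ≤ b) (hK0 : 0 ≤ Kg) (hKg : ∀ U U', ‖g U - g U'‖ ≤ Kg * ‖coeConfig U - coeConfig U'‖)
    (hS : Measurable S) (hs : ∀ u, |S u| ≤ s)
    (h1 : nstep * ε ≤ sunShortTrajThreshold (sunCoordι N) (sunCoordι_injective N))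
    (h2 : (2 * nstep + 1) * b ≤ sunShortTrajThreshold (sunCoordι N) (sunCoordι_injective N))
    (h3 : Kg * ε * (nstep : ℝ) ^ 2 ≤ sunShortTrajThreshold (sunCoordι N) (sunCoordι_injective N))
    {f : (L → Matrix.specialUnitaryGroup (Fin N) ℂ) → ℝ} (hf : Measurable f) {C : ℝ}
    (hC : ∀ U, |f U| ≤ C) (μ₀ : Measure (L → Matrix.specialUnitaryGroup (Fin N) ℂ))
    [IsProbabilityMeasure μ₀]
    {Ω' : Type*} [MeasurableSpace Ω'] {P' : Measure Ω'} [IsProbabilityMeasure P'] {Y : Ω' → ℝ}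
    (hY : HasLaw Y (gaussianReal 0 (Real.toNNReal
      ((∫ y, (f y - ∫ z, f z ∂(gibbsProbability (Measure.pi fun _ : L =>
            haarProbability (Matrix.specialUnitaryGroup (Fin N) ℂ)) fun u => Real.exp (-S u))) ^ 2
          ∂(gibbsProbability (Measure.pi fun _ : L =>
            haarProbability (Matrix.specialUnitaryGroup (Fin N) ℂ)) fun u => Real.exp (-S u)))
        + 2 * ∑' j, ∫ y, (f y - ∫ z, f z ∂(gibbsProbability (Measure.pi fun _ : L =>
            haarProbability (Matrix.specialUnitaryGroup (Fin N) ℂ)) fun u => Real.exp (-S u)))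
          * (kop (sunLeapfrogHMCN (sunCoordι N) (sunCoordι_skew N) ε
              (Measure.addHaar : Measure (SUNCoords N)) (sunKinetic N) hg S nstep))^[j + 1]
            (fun y => f y - ∫ z, f z ∂(gibbsProbability (Measure.pi fun _ : L =>
              haarProbability (Matrix.specialUnitaryGroup (Fin N) ℂ)) fun u => Real.exp (-S u))) y
          ∂(gibbsProbability (Measure.pi fun _ : L =>
            haarProbability (Matrix.specialUnitaryGroup (Fin N) ℂ)) fun u => Real.exp (-S u))))) P')
    [hK : IsMarkovKernel (sunLeapfrogHMCN (sunCoordι N) (sunCoordι_skew N) ε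
      (Measure.addHaar : Measure (SUNCoords N)) (sunKinetic N) hg S nstep)]
    [IsProbabilityMeasure (Kernel.trajMeasure (X := fun _ : ℕ => L → Matrix.specialUnitaryGroup (Fin N) ℂ) μ₀
        (fun t : ℕ => (sunLeapfrogHMCN (sunCoordι N) (sunCoordι_skew N) ε
            (Measure.addHaar : Measure (SUNCoords N)) (sunKinetic N) hg S nstep).comap
          (fun h : (i : ↥(Finset.Iic t)) → (L → Matrix.specialUnitaryGroup (Fin N) ℂ) =>
            h ⟨t, Finset.mem_Iic.2 le_rfl⟩) (measurable_pi_apply _)))] :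
    TendstoInDistribution (fun (N' : ℕ) (x : ℕ → L → Matrix.specialUnitaryGroup (Fin N) ℂ) =>
        (Real.sqrt N')⁻¹ * ∑ t ∈ Finset.range N',
          (f (x t) - ∫ z, f z ∂(gibbsProbability (Measure.pi fun _ : L =>
            haarProbability (Matrix.specialUnitaryGroup (Fin N) ℂ)) fun u => Real.exp (-S u))))
      atTop Y (fun _ => (Kernel.trajMeasure (X := fun _ : ℕ => L → Matrix.specialUnitaryGroup (Fin N) ℂ) μ₀
        (fun t : ℕ => (sunLeapfrogHMCN (sunCoordι N) (sunCoordι_skew N) ε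
            (Measure.addHaar : Measure (SUNCoords N)) (sunKinetic N) hg S nstep).comap
          (fun h : (i : ↥(Finset.Iic t)) → (L → Matrix.specialUnitaryGroup (Fin N) ℂ) =>
            h ⟨t, Finset.mem_Iic.2 le_rfl⟩) (measurable_pi_apply _)))) P' := by
  obtain ⟨hlo, hhi⟩ := gibbsWeight_pinched (L := L) (n := Fin N) hs
  haveI := isProbabilityMeasure_gibbsProbability
    (μ := Measure.pi fun _ : L => haarProbability (Matrix.specialUnitaryGroup (Fin N) ℂ))
    (Real.exp_pos (-s)) hlo hhi
  obtain ⟨hπ, m, ε', hm, hε0, -, hmin⟩ := sunLeapfrogHMCN_certificate N hε hn hg hb0 hb hK0 hKg hS hs h1 h2 h3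
  exact Exactness.GeneralNCMC.tendstoInDistribution_timeAverage_of_nHit hπ hε0.ne' hmin hm hf hC μ₀ hY

/-- **BATCH MEANS ESTIMATE `σ²_f` CONSISTENTLY ALONG THE ENGINE'S `SU(N)` LEAPFROG HMC, FROM EVERY
INITIAL LAW**: `a b · SE²_BM → σ²_f` in probability as `a, b → ∞`. -/
theorem sunLeapfrogHMCN_batchMeans_tendstoInMeasure (hε : 0 < ε) (hn : 1 ≤ nstep) (hg : Measurable g) (hb0 : 0 ≤ b)
    (hb : ∀ u l, ‖g u l‖ ≤ b) (hK0 : 0 ≤ Kg) (hKg : ∀ U U', ‖g U - g U'‖ ≤ Kg * ‖coeConfig U - coeConfig U'‖)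
    (hS : Measurable S) (hs : ∀ u, |S u| ≤ s)
    (h1 : nstep * ε ≤ sunShortTrajThreshold (sunCoordι N) (sunCoordι_injective N))
    (h2 : (2 * nstep + 1) * b ≤ sunShortTrajThreshold (sunCoordι N) (sunCoordι_injective N))
    (h3 : Kg * ε * (nstep : ℝ) ^ 2 ≤ sunShortTrajThreshold (sunCoordι N) (sunCoordι_injective N))
    {f : (L → Matrix.specialUnitaryGroup (Fin N) ℂ) → ℝ} (hf : Measurable f) {C : ℝ}
    (hC : ∀ U, |f U| ≤ C) (μ₀ : Measure (L → Matrix.specialUnitaryGroup (Fin N) ℂ))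
    [IsProbabilityMeasure μ₀] {a b' : ℕ → ℕ} (ha : Tendsto a atTop atTop) (hb' : Tendsto b' atTop atTop)
    [hK : IsMarkovKernel (sunLeapfrogHMCN (sunCoordι N) (sunCoordι_skew N) ε
      (Measure.addHaar : Measure (SUNCoords N)) (sunKinetic N) hg S nstep)] :
    TendstoInMeasure (Kernel.trajMeasure (X := fun _ : ℕ => L → Matrix.specialUnitaryGroup (Fin N) ℂ) μ₀
        (fun t : ℕ => (sunLeapfrogHMCN (sunCoordι N) (sunCoordι_skew N) ε
            (Measure.addHaar : Measure (SUNCoords N)) (sunKinetic N) hg S nstep).comap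
          (fun h : (i : ↥(Finset.Iic t)) → (L → Matrix.specialUnitaryGroup (Fin N) ℂ) =>
            h ⟨t, Finset.mem_Iic.2 le_rfl⟩) (measurable_pi_apply _)))
      (fun (N' : ℕ) (x : ℕ → L → Matrix.specialUnitaryGroup (Fin N) ℂ) => ((b' N' * a N' : ℕ) : ℝ)
        * replicaSEsq (fun j (x : ℕ → L → Matrix.specialUnitaryGroup (Fin N) ℂ) =>
            (∑ i ∈ Finset.range (b' N'), f (x (b' N' * j + i))) / (b' N')) (a N') x)
      atTop (fun _ =>
        (∫ y, (f y - ∫ z, f z ∂(gibbsProbability (Measure.pi fun _ : L =>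
            haarProbability (Matrix.specialUnitaryGroup (Fin N) ℂ)) fun u => Real.exp (-S u))) ^ 2
          ∂(gibbsProbability (Measure.pi fun _ : L =>
            haarProbability (Matrix.specialUnitaryGroup (Fin N) ℂ)) fun u => Real.exp (-S u)))
        + 2 * ∑' j, ∫ y, (f y - ∫ z, f z ∂(gibbsProbability (Measure.pi fun _ : L =>
            haarProbability (Matrix.specialUnitaryGroup (Fin N) ℂ)) fun u => Real.exp (-S u)))
          * (kop (sunLeapfrogHMCN (sunCoordι N) (sunCoordι_skew N) ε
              (Measure.addHaar : Measure (SUNCoords N)) (sunKinetic N) hg S nstep))^[j + 1]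
            (fun y => f y - ∫ z, f z ∂(gibbsProbability (Measure.pi fun _ : L =>
              haarProbability (Matrix.specialUnitaryGroup (Fin N) ℂ)) fun u => Real.exp (-S u))) y
          ∂(gibbsProbability (Measure.pi fun _ : L =>
            haarProbability (Matrix.specialUnitaryGroup (Fin N) ℂ)) fun u => Real.exp (-S u))) := by
  obtain ⟨hlo, hhi⟩ := gibbsWeight_pinched (L := L) (n := Fin N) hs
  haveI := isProbabilityMeasure_gibbsProbability
    (μ := Measure.pi fun _ : L => haarProbability (Matrix.specialUnitaryGroup (Fin N) ℂ))
    (Real.exp_pos (-s)) hlo hhi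
  obtain ⟨hπ, m, ε', hm, hε0, hε1, hmin⟩ := sunLeapfrogHMCN_certificate N hε hn hg hb0 hb hK0 hKg hS hs h1 h2 h3
  exact chain_batchMeans_sigmaHat_tendstoInMeasure_of_nHit hπ
    (Exactness.GeneralNCMC.minorised_setwise hmin) hε0 hε1 hm hf hC μ₀ ha hb'

/-- **THE COIN-FREE BATCH-MEANS INTERVAL OF AN `SU(N)` HMC RUN IS ASYMPTOTICALLY EXACT**
(`σ²_f > 0`, `a, b → ∞`, any initial law, `z > 0`):
`P_{μ₀}(|√N' (f̄_{N'} − π_S f)| ≤ z σ̂_BM) → (gaussianReal 0 1)[−z, z]`, `N' = b a`. -/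
theorem sunLeapfrogHMCN_batchMeans_coverage (hε : 0 < ε) (hn : 1 ≤ nstep) (hg : Measurable g) (hb0 : 0 ≤ b)
    (hb : ∀ u l, ‖g u l‖ ≤ b) (hK0 : 0 ≤ Kg) (hKg : ∀ U U', ‖g U - g U'‖ ≤ Kg * ‖coeConfig U - coeConfig U'‖)
    (hS : Measurable S) (hs : ∀ u, |S u| ≤ s)
    (h1 : nstep * ε ≤ sunShortTrajThreshold (sunCoordι N) (sunCoordι_injective N))
    (h2 : (2 * nstep + 1) * b ≤ sunShortTrajThreshold (sunCoordι N) (sunCoordι_injective N))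
    (h3 : Kg * ε * (nstep : ℝ) ^ 2 ≤ sunShortTrajThreshold (sunCoordι N) (sunCoordι_injective N))
    {f : (L → Matrix.specialUnitaryGroup (Fin N) ℂ) → ℝ} (hf : Measurable f) {C : ℝ}
    (hC : ∀ U, |f U| ≤ C)
    (hσ : 0 < (∫ y, (f y - ∫ z, f z ∂(gibbsProbability (Measure.pi fun _ : L =>
            haarProbability (Matrix.specialUnitaryGroup (Fin N) ℂ)) fun u => Real.exp (-S u))) ^ 2
          ∂(gibbsProbability (Measure.pi fun _ : L =>
            haarProbability (Matrix.specialUnitaryGroup (Fin N) ℂ)) fun u => Real.exp (-S u)))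
        + 2 * ∑' j, ∫ y, (f y - ∫ z, f z ∂(gibbsProbability (Measure.pi fun _ : L =>
            haarProbability (Matrix.specialUnitaryGroup (Fin N) ℂ)) fun u => Real.exp (-S u)))
          * (kop (sunLeapfrogHMCN (sunCoordι N) (sunCoordι_skew N) ε
              (Measure.addHaar : Measure (SUNCoords N)) (sunKinetic N) hg S nstep))^[j + 1]
            (fun y => f y - ∫ z, f z ∂(gibbsProbability (Measure.pi fun _ : L =>
              haarProbability (Matrix.specialUnitaryGroup (Fin N) ℂ)) fun u => Real.exp (-S u))) y
          ∂(gibbsProbability (Measure.pi fun _ : L =>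
            haarProbability (Matrix.specialUnitaryGroup (Fin N) ℂ)) fun u => Real.exp (-S u)))
    (μ₀ : Measure (L → Matrix.specialUnitaryGroup (Fin N) ℂ)) [IsProbabilityMeasure μ₀]
    {a b' : ℕ → ℕ} (ha : Tendsto a atTop atTop) (hb' : Tendsto b' atTop atTop) {z : ℝ} (hz : 0 < z)
    [hK : IsMarkovKernel (sunLeapfrogHMCN (sunCoordι N) (sunCoordι_skew N) ε
      (Measure.addHaar : Measure (SUNCoords N)) (sunKinetic N) hg S nstep)] :
    Tendsto (fun N' : ℕ => (Kernel.trajMeasure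
        (X := fun _ : ℕ => L → Matrix.specialUnitaryGroup (Fin N) ℂ) μ₀
        (fun t : ℕ => (sunLeapfrogHMCN (sunCoordι N) (sunCoordι_skew N) ε
            (Measure.addHaar : Measure (SUNCoords N)) (sunKinetic N) hg S nstep).comap
          (fun h : (i : ↥(Finset.Iic t)) → (L → Matrix.specialUnitaryGroup (Fin N) ℂ) =>
            h ⟨t, Finset.mem_Iic.2 le_rfl⟩) (measurable_pi_apply _))).real
      {x | |((Real.sqrt ((b' N' * a N' : ℕ) : ℝ))⁻¹
          * ∑ t ∈ Finset.range (b' N' * a N'),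
            (f (x t) - ∫ z, f z ∂(gibbsProbability (Measure.pi fun _ : L =>
              haarProbability (Matrix.specialUnitaryGroup (Fin N) ℂ)) fun u => Real.exp (-S u))))
        / Real.sqrt (((b' N' * a N' : ℕ) : ℝ)
          * replicaSEsq (fun j (x : ℕ → L → Matrix.specialUnitaryGroup (Fin N) ℂ) =>
              (∑ i ∈ Finset.range (b' N'), f (x (b' N' * j + i))) / (b' N')) (a N') x)| ≤ z})
      atTop (𝓝 ((gaussianReal 0 1).real (Set.Icc (-z) z))) := by
  obtain ⟨hlo, hhi⟩ := gibbsWeight_pinched (L := L) (n := Fin N) hs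
  haveI := isProbabilityMeasure_gibbsProbability
    (μ := Measure.pi fun _ : L => haarProbability (Matrix.specialUnitaryGroup (Fin N) ℂ))
    (Real.exp_pos (-s)) hlo hhi
  obtain ⟨hπ, m, ε', hm, hε0, hε1, hmin⟩ := sunLeapfrogHMCN_certificate N hε hn hg hb0 hb hK0 hKg hS hs h1 h2 h3
  exact doeblinPower_batchMeans_studentized_coverage hπ hmin hε0 hε1 hm hf hC hσ μ₀ ha hb' hz

/-- **THE REPORTED `τ̂_int = σ̂²_BM/(2 v̂)` OF AN `SU(N)` HMC RUN IS CONSISTENT** (`Var f ≠ 0`,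
`a, b → ∞`, any initial law): `σ̂²/(2 v̂) → τ_int(ρ_f)` in probability. -/
theorem sunLeapfrogHMCN_tauInt_tendstoInMeasure (hε : 0 < ε) (hn : 1 ≤ nstep) (hg : Measurable g) (hb0 : 0 ≤ b)
    (hb : ∀ u l, ‖g u l‖ ≤ b) (hK0 : 0 ≤ Kg) (hKg : ∀ U U', ‖g U - g U'‖ ≤ Kg * ‖coeConfig U - coeConfig U'‖)
    (hS : Measurable S) (hs : ∀ u, |S u| ≤ s)
    (h1 : nstep * ε ≤ sunShortTrajThreshold (sunCoordι N) (sunCoordι_injective N))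
    (h2 : (2 * nstep + 1) * b ≤ sunShortTrajThreshold (sunCoordι N) (sunCoordι_injective N))
    (h3 : Kg * ε * (nstep : ℝ) ^ 2 ≤ sunShortTrajThreshold (sunCoordι N) (sunCoordι_injective N))
    {f : (L → Matrix.specialUnitaryGroup (Fin N) ℂ) → ℝ} (hf : Measurable f) {C : ℝ}
    (hC : ∀ U, |f U| ≤ C)
    (hvar : autocov (sunLeapfrogHMCN (sunCoordι N) (sunCoordι_skew N) ε
        (Measure.addHaar : Measure (SUNCoords N)) (sunKinetic N) hg S nstep)
      (gibbsProbability (Measure.pi fun _ : L =>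
        haarProbability (Matrix.specialUnitaryGroup (Fin N) ℂ)) fun u => Real.exp (-S u))
      (fun y => f y - ∫ z, f z ∂(gibbsProbability (Measure.pi fun _ : L =>
        haarProbability (Matrix.specialUnitaryGroup (Fin N) ℂ)) fun u => Real.exp (-S u))) 0 ≠ 0)
    (μ₀ : Measure (L → Matrix.specialUnitaryGroup (Fin N) ℂ)) [IsProbabilityMeasure μ₀]
    {a b' : ℕ → ℕ} (ha : Tendsto a atTop atTop) (hb' : Tendsto b' atTop atTop)
    [hK : IsMarkovKernel (sunLeapfrogHMCN (sunCoordι N) (sunCoordι_skew N) ε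
      (Measure.addHaar : Measure (SUNCoords N)) (sunKinetic N) hg S nstep)] :
    TendstoInMeasure (Kernel.trajMeasure (X := fun _ : ℕ => L → Matrix.specialUnitaryGroup (Fin N) ℂ) μ₀
        (fun t : ℕ => (sunLeapfrogHMCN (sunCoordι N) (sunCoordι_skew N) ε
            (Measure.addHaar : Measure (SUNCoords N)) (sunKinetic N) hg S nstep).comap
          (fun h : (i : ↥(Finset.Iic t)) → (L → Matrix.specialUnitaryGroup (Fin N) ℂ) =>
            h ⟨t, Finset.mem_Iic.2 le_rfl⟩) (measurable_pi_apply _)))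
      (fun (N' : ℕ) (x : ℕ → L → Matrix.specialUnitaryGroup (Fin N) ℂ) =>
        (((b' N' * a N' : ℕ) : ℝ)
          * replicaSEsq (fun j (x : ℕ → L → Matrix.specialUnitaryGroup (Fin N) ℂ) =>
              (∑ i ∈ Finset.range (b' N'), f (x (b' N' * j + i))) / (b' N')) (a N') x)
        / (2 * ((∑ t ∈ Finset.range (b' N' * a N'), f (x t) ^ 2) / ((b' N' * a N' : ℕ) : ℝ)
            - ((∑ t ∈ Finset.range (b' N' * a N'), f (x t)) / ((b' N' * a N' : ℕ) : ℝ)) ^ 2)))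
      atTop (fun _ => tauInt (fun t =>
        autocov (sunLeapfrogHMCN (sunCoordι N) (sunCoordι_skew N) ε
            (Measure.addHaar : Measure (SUNCoords N)) (sunKinetic N) hg S nstep)
          (gibbsProbability (Measure.pi fun _ : L =>
            haarProbability (Matrix.specialUnitaryGroup (Fin N) ℂ)) fun u => Real.exp (-S u))
          (fun y => f y - ∫ z, f z ∂(gibbsProbability (Measure.pi fun _ : L =>
            haarProbability (Matrix.specialUnitaryGroup (Fin N) ℂ)) fun u => Real.exp (-S u))) t
        / autocov (sunLeapfrogHMCN (sunCoordι N) (sunCoordι_skew N) ε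
            (Measure.addHaar : Measure (SUNCoords N)) (sunKinetic N) hg S nstep)
          (gibbsProbability (Measure.pi fun _ : L =>
            haarProbability (Matrix.specialUnitaryGroup (Fin N) ℂ)) fun u => Real.exp (-S u))
          (fun y => f y - ∫ z, f z ∂(gibbsProbability (Measure.pi fun _ : L =>
            haarProbability (Matrix.specialUnitaryGroup (Fin N) ℂ)) fun u => Real.exp (-S u))) 0)) := by
  obtain ⟨hlo, hhi⟩ := gibbsWeight_pinched (L := L) (n := Fin N) hs
  haveI := isProbabilityMeasure_gibbsProbability
    (μ := Measure.pi fun _ : L => haarProbability (Matrix.specialUnitaryGroup (Fin N) ℂ))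
    (Real.exp_pos (-s)) hlo hhi
  obtain ⟨hπ, m, ε', hm, hε0, hε1, hmin⟩ := sunLeapfrogHMCN_certificate N hε hn hg hb0 hb hK0 hKg hS hs h1 h2 h3
  exact chain_batchMeans_tauInt_tendstoInMeasure_of_nHit hπ hmin hε0 hε1 hm hf hC hvar μ₀ ha hb'

end HMC

/-! ## The Wilson action on the torus -/

section Wilson

variable (N : ℕ) [NeZero N] {d L M : ℕ}
  (ρ : Matrix.specialUnitaryGroup (Fin N) ℂ →* Matrix (Fin M) (Fin M) ℂ) {ε : ℝ} {nstep : ℕ}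
  {g : GaugeConfig d L (Matrix.specialUnitaryGroup (Fin N) ℂ) → Edge d L → SUNCoords N} {b Kg : ℝ}

/-- **THE ENGINE'S `SU(N)` HMC FOR THE WILSON ACTION: BATCH MEANS ARE CONSISTENT FOR `σ²_f`, FROM
EVERY START** (continuous `ρ`, any `β`, step `ε > 0`, any measurable momentum increment bounded by
`b ≥ 0`, `|f| ≤ C` measurable, `a, b → ∞`). -/
theorem wilson_sunLeapfrogHMCN_batchMeans_tendstoInMeasure [NeZero L] (hρ : Continuous ρ) (β : ℝ)
    (hε : 0 < ε) (hn : 1 ≤ nstep) (hg : Measurable g) (hb0 : 0 ≤ b) (hb : ∀ U e, ‖g U e‖ ≤ b) (hK0 : 0 ≤ Kg)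
    (hKg : ∀ U U', ‖g U - g U'‖ ≤ Kg * ‖coeConfig U - coeConfig U'‖)
    (h1 : nstep * ε ≤ sunShortTrajThreshold (sunCoordι N) (sunCoordι_injective N))
    (h2 : (2 * nstep + 1) * b ≤ sunShortTrajThreshold (sunCoordι N) (sunCoordι_injective N))
    (h3 : Kg * ε * (nstep : ℝ) ^ 2 ≤ sunShortTrajThreshold (sunCoordι N) (sunCoordι_injective N))
    {f : GaugeConfig d L (Matrix.specialUnitaryGroup (Fin N) ℂ) → ℝ} (hf : Measurable f) {C : ℝ}
    (hC : ∀ U, |f U| ≤ C) (μ₀ : Measure (GaugeConfig d L (Matrix.specialUnitaryGroup (Fin N) ℂ)))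
    [IsProbabilityMeasure μ₀] {a b' : ℕ → ℕ} (ha : Tendsto a atTop atTop) (hb' : Tendsto b' atTop atTop)
    [hK : IsMarkovKernel (sunLeapfrogHMCN (sunCoordι N) (sunCoordι_skew N) ε
      (Measure.addHaar : Measure (SUNCoords N)) (sunKinetic N) hg (fun U => β * wilsonAction ρ U) nstep)] :
    TendstoInMeasure (Kernel.trajMeasure
        (X := fun _ : ℕ => GaugeConfig d L (Matrix.specialUnitaryGroup (Fin N) ℂ)) μ₀
        (fun t : ℕ => (sunLeapfrogHMCN (sunCoordι N) (sunCoordι_skew N) ε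
            (Measure.addHaar : Measure (SUNCoords N)) (sunKinetic N) hg
            (fun U => β * wilsonAction ρ U) nstep).comap
          (fun h : (i : ↥(Finset.Iic t)) → GaugeConfig d L (Matrix.specialUnitaryGroup (Fin N) ℂ) =>
            h ⟨t, Finset.mem_Iic.2 le_rfl⟩) (measurable_pi_apply _)))
      (fun (N' : ℕ) (x : ℕ → GaugeConfig d L (Matrix.specialUnitaryGroup (Fin N) ℂ)) =>
        ((b' N' * a N' : ℕ) : ℝ)
        * replicaSEsq (fun j (x : ℕ → GaugeConfig d L (Matrix.specialUnitaryGroup (Fin N) ℂ)) =>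
            (∑ i ∈ Finset.range (b' N'), f (x (b' N' * j + i))) / (b' N')) (a N') x)
      atTop (fun _ =>
        (∫ y, (f y - ∫ z, f z ∂(wilsonMeasure (d := d) (L := L) ρ β)) ^ 2 ∂(wilsonMeasure (d := d) (L := L) ρ β))
        + 2 * ∑' j, ∫ y, (f y - ∫ z, f z ∂(wilsonMeasure (d := d) (L := L) ρ β))
          * (kop (sunLeapfrogHMCN (sunCoordι N) (sunCoordι_skew N) ε
              (Measure.addHaar : Measure (SUNCoords N)) (sunKinetic N) hg
              (fun U => β * wilsonAction ρ U) nstep))^[j + 1]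
            (fun y => f y - ∫ z, f z ∂(wilsonMeasure (d := d) (L := L) ρ β)) y
          ∂(wilsonMeasure (d := d) (L := L) ρ β)) := by
  obtain ⟨s, hs⟩ := exists_bound_smul_wilsonAction_sun N (d := d) (L := L) ρ hρ β
  rw [← gibbsProbability_smul_wilsonAction_eq N (d := d) (L := L) ρ β]
  exact sunLeapfrogHMCN_batchMeans_tendstoInMeasure N hε hn hg hb0 hb hK0 hKg
    (continuous_smul_wilsonAction ρ hρ β).measurable hs h1 h2 h3 hf hC μ₀ ha hb'

/-- **THE ENGINE'S `SU(N)` HMC FOR THE WILSON ACTION: THE BATCH-MEANS INTERVAL IS ASYMPTOTICALLY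
EXACT** (`σ²_f > 0`, `z > 0`, any start): `P_{μ₀}(|√N' (f̄_{N'} − ⟨f⟩_β)| ≤ z σ̂_BM) → (gaussianReal 0 1)[−z, z]`. -/
theorem wilson_sunLeapfrogHMCN_batchMeans_coverage [NeZero L] (hρ : Continuous ρ) (β : ℝ)
    (hε : 0 < ε) (hn : 1 ≤ nstep) (hg : Measurable g) (hb0 : 0 ≤ b) (hb : ∀ U e, ‖g U e‖ ≤ b) (hK0 : 0 ≤ Kg)
    (hKg : ∀ U U', ‖g U - g U'‖ ≤ Kg * ‖coeConfig U - coeConfig U'‖)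
    (h1 : nstep * ε ≤ sunShortTrajThreshold (sunCoordι N) (sunCoordι_injective N))
    (h2 : (2 * nstep + 1) * b ≤ sunShortTrajThreshold (sunCoordι N) (sunCoordι_injective N))
    (h3 : Kg * ε * (nstep : ℝ) ^ 2 ≤ sunShortTrajThreshold (sunCoordι N) (sunCoordι_injective N))
    {f : GaugeConfig d L (Matrix.specialUnitaryGroup (Fin N) ℂ) → ℝ} (hf : Measurable f) {C : ℝ}
    (hC : ∀ U, |f U| ≤ C)
    (hσ : 0 < (∫ y, (f y - ∫ z, f z ∂(wilsonMeasure (d := d) (L := L) ρ β)) ^ 2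
          ∂(wilsonMeasure (d := d) (L := L) ρ β))
        + 2 * ∑' j, ∫ y, (f y - ∫ z, f z ∂(wilsonMeasure (d := d) (L := L) ρ β))
          * (kop (sunLeapfrogHMCN (sunCoordι N) (sunCoordι_skew N) ε
              (Measure.addHaar : Measure (SUNCoords N)) (sunKinetic N) hg
              (fun U => β * wilsonAction ρ U) nstep))^[j + 1]
            (fun y => f y - ∫ z, f z ∂(wilsonMeasure (d := d) (L := L) ρ β)) y
          ∂(wilsonMeasure (d := d) (L := L) ρ β))
    (μ₀ : Measure (GaugeConfig d L (Matrix.specialUnitaryGroup (Fin N) ℂ))) [IsProbabilityMeasure μ₀]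
    {a b' : ℕ → ℕ} (ha : Tendsto a atTop atTop) (hb' : Tendsto b' atTop atTop) {z : ℝ} (hz : 0 < z)
    [hK : IsMarkovKernel (sunLeapfrogHMCN (sunCoordι N) (sunCoordι_skew N) ε
      (Measure.addHaar : Measure (SUNCoords N)) (sunKinetic N) hg (fun U => β * wilsonAction ρ U) nstep)] :
    Tendsto (fun N' : ℕ => (Kernel.trajMeasure
        (X := fun _ : ℕ => GaugeConfig d L (Matrix.specialUnitaryGroup (Fin N) ℂ)) μ₀
        (fun t : ℕ => (sunLeapfrogHMCN (sunCoordι N) (sunCoordι_skew N) ε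
            (Measure.addHaar : Measure (SUNCoords N)) (sunKinetic N) hg
            (fun U => β * wilsonAction ρ U) nstep).comap
          (fun h : (i : ↥(Finset.Iic t)) → GaugeConfig d L (Matrix.specialUnitaryGroup (Fin N) ℂ) =>
            h ⟨t, Finset.mem_Iic.2 le_rfl⟩) (measurable_pi_apply _))).real
      {x | |((Real.sqrt ((b' N' * a N' : ℕ) : ℝ))⁻¹
          * ∑ t ∈ Finset.range (b' N' * a N'),
            (f (x t) - ∫ z, f z ∂(wilsonMeasure (d := d) (L := L) ρ β)))
        / Real.sqrt (((b' N' * a N' : ℕ) : ℝ)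
          * replicaSEsq (fun j (x : ℕ → GaugeConfig d L (Matrix.specialUnitaryGroup (Fin N) ℂ)) =>
              (∑ i ∈ Finset.range (b' N'), f (x (b' N' * j + i))) / (b' N')) (a N') x)| ≤ z})
      atTop (𝓝 ((gaussianReal 0 1).real (Set.Icc (-z) z))) := by
  obtain ⟨s, hs⟩ := exists_bound_smul_wilsonAction_sun N (d := d) (L := L) ρ hρ β
  rw [← gibbsProbability_smul_wilsonAction_eq N (d := d) (L := L) ρ β] at hσ ⊢
  exact sunLeapfrogHMCN_batchMeans_coverage N hε hn hg hb0 hb hK0 hKg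
    (continuous_smul_wilsonAction ρ hρ β).measurable hs h1 h2 h3 hf hC hσ μ₀ ha hb' hz

end Wilson

end Summit.Ventures.LatticeQCDFlow.Scoring

end
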